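import Mathlib
import Literature.MathematicalPhysics.QuantumFieldTheory.Balaban1983to89.T4CauchySum

/-!
# T4EtaRateMin — typed HYPOTHESIS SHAPES for the η-rate of the background-field minimisers (cell `pub-balaban`, T4-DAG v1 node U1 (b), new estimate NE3, row T4-U1b.E; bookkeeping)

HONEST FRAMING (cell `pub-balaban`, T4-DAG v1 PAGE 1).  The cell's T4 target is the existence AND uniqueness of the
continuum limit of Bałaban's unit-scale averaged loop expectations on a finite torus — a constructive-QFT statement
strictly beyond ultraviolet stability; it is NOT the Yang–Mills mass gap and NOT the Clay problem.  This module is pure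
bookkeeping for the cell's NEW ESTIMATE NE3 ("η-rate of the minimisers", node U1 (b)): it asserts NOTHING about
Bałaban's minimal configurations `U_k(V)`.  Every `def … : Prop` below is a HYPOTHESIS SHAPE over an ABSTRACT carrier
(a predicate, never used as a fact); every theorem is elementary real analysis (telescoping, geometric series, Cauchy
sequences in `ℝ`, finite sums).  The estimate that would instantiate the shapes for Bałaban's minimisers is NOT in
print (see "What is NOT printed").  Value = typed hypothesis shapes + kernel bookkeeping of `shape ⇒ limits / King's
n-uniform form / local ⇒ global`; NOT summit progress.

WHAT NE3 IS (cell-internal target, T4-DAG v1 §5 row T4-U1b.E and §6; NOT a published statement): for the SAME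
unit-lattice datum `V` (small field, `|∂V − 1| < ε₁`), compare the constrained minimiser of the Wilson action on the
`ε = L^{−k}` lattice (run A, `k` steps) with the one on the `ε/L` lattice (run B, `k + 1` steps) — as gauge-fixed fields
at corresponding points (King's convention `x′ ∈ B^n(x)`), through gauge-invariant unit-scale local functions, and
through the minimal action values `|A^ε − A^{ε/L}| ≤ C θ_A^k |T₁|` — with a GEOMETRIC rate `θ^k`, `θ < 1`, uniformly in
`V` in the small-field domain.  Record: HOME/t4/T4-EST-U1b.md (this seat).

PRINTED CONTEXT (verbatim; pages read by this seat on the rendered journal pages; the manuscripts under audit —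
Bałaban CMP 102 (1985) 277–309 = [Balaban1985Variational] — are quoted for what they STATE, never as establishing a
disputed step; King CMP 102 (1986) is outside the audited series).
* What IS printed about the minimisers is EXISTENCE, UNIQUENESS and REGULARITY with constants UNIFORM in the lattice
  spacing — [Balaban1985Variational] Thm 1 p. 279: "Theorem 1. There exist positive constants a₀, a₁, B₃, B₄(β₀),
  M(ε₁), B₃a₁ ≤ a₀, such that for an arbitrary configuration V satisfying (7) with ε₁ ≤ a₁ there exists a minimal
  orbit in the space 𝔘_k({Ω_j}, B₃ε₁) ∩ 𝔅_k(𝔅_k, V). (8) This orbit is a unique critical orbit in the space (6) if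
  B₃ε₁ ≤ ε₀ and ε₀ ≤ a₀." … "The constants a₀, a₁, B₃, depend on d and L only, the constants B₄(β₀), M(ε₁) depend on
  the indicated parameters also. More exactly M(ε₁) = R₁M₁(a₁/ε₁). Minimal configurations will be denoted by U_k(V),
  or U_k." … "Theorem 1 will be proved by induction with respect to k." [cite: Balaban1985Variational, Thm 1 p. 279]
* The printed TEMPLATE of an η-comparison with a rate is the A = 0, U(1)-Higgs statement of C. King, CMP 102 (1986)
  649–677, p. 664: "So we reduce to the case with S^c empty, i.e. we must bound |E^{(k)}(H̃) − E_φ^{(k+n)}(H̃)|. This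
  is done by replacing one by one every factor in E_φ^{(k+n)}(H̃) by the corresponding factor in E^{(k)}(H̃), and
  bounding the error at each step. First, we replace the propagators on the external lines, using the following
  proposition proved in Sect. 4. When x′ ∈ T_{η′}, we denote by x that point in T_η for which x′ ∈ B^n(x).
  Proposition 3.8. For x′, y′ ∈ T_{η′}, 0 < α < 1, and γ sufficiently small, |a_{k+n}G^{η′}_{k+n}Q*_{k+n}(x′, z) −
  a_kG^η_kQ*_k(x, z)|, … ≤ CL^{−γk} exp[−δ₀{|x − z|, dist({x, y}, z)}]. (3.71)" — a bound for `k + n` versus `k`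
  steps with a constant INDEPENDENT of `n` (§3 below shows the consecutive-step shape implies this n-uniform form) —
  and its mechanism, p. 670: "The basis for our proof is an explicit Fourier representation for a_kG_kQ*_k."
  [cite: King1986, Prop. 3.8 (3.71) p. 664; Sect. 4 (4.1)–(4.2) p. 670]

WHAT IS NOT PRINTED (census of the cell's cross-read T4-XREAD-U1b §0 (b), §3 — pages B8 p. 87, B11 pp. 278–281, 299,
309, B10 pp. 266–268, B12 pp. 259, 265 read there; consistent with this seat's reading of B11 p. 279): any comparison
of `U_k^{(η)}(V)` with `U_{k+1}^{(η/L)}(V)` for the same coarse datum `V` — directly, through averages, through the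
actions `A^η(U_k(V))` versus `A^{η/L}(U_{k+1}(V))`, or through any gauge-invariant function —, any `η → 0` limit of
minimisers, any rate.  Printed are: uniformity of all constants in `η` (above), level-NESTING identities at FIXED `η`
([Balaban1985Variational] (11)–(14); [Balaban1987RG1] (2.3) p. 265), and analyticity in the data (Prop. 9 p. 309).
In the non-linear, non-abelian setting no counterpart of King's (3.71) is printed, and King's mechanism (an explicit
Fourier representation) is not available as such.

WHAT IS PROVED HERE (all [folklore]; `R : Readings ι X` an abstract carrier: `R.dom` the admissible data, `R.act k V`
a real number per number of steps `k` and datum `V` — intended reading: the minimal action value of the k-step run —,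
`R.loc k V x` a real number per `k`, `V` and unit-scale site `x` — intended reading: a gauge-invariant local function of
the minimiser, or a gauge-fixed component at corresponding points —, `R.vol ≥ 0` — intended reading `|T₁|`).
§1 shapes `ActionRate R C θ` (`|act (k+1) V − act k V| ≤ C θ^k vol`), `LocalRate R C θ` (`|loc (k+1) V x − loc k V x|
≤ C θ^k`), `NE3Shape` = both with `0 ≤ θ < 1`; dictionary to `T4CauchySum.GeomRate` (node U6's input shape).
§2 consequences: limits exist with the geometric TAIL `C θ^k / (1 − θ)` (`ActionRate.exists_limit`,
`LocalRate.exists_limit`); §3 the consecutive shape implies KING'S n-UNIFORM SHAPE `|loc (k+n) − loc k| ≤ C θ^k/(1−θ)`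
for every `n` (`LocalRate.multiStep`, `ActionRate.multiStep`) — the form of (3.71); §4 LOCAL ⇒ GLOBAL: if the action
value is the sum of the local readings over the unit-scale sites and `card X ≤ vol`, `LocalRate ⇒ ActionRate` with the
same constants (`actionRate_of_localRate`) — the meaning of the factor `|T₁|` in NE3; §5 the RESIDUAL MECHANISM as a
shape: a uniform response bound `Γ` (R1: of the printed η-uniform TYPE — inverse of the linearised constrained
Euler–Lagrange operator) times a residual of geometric size (R2: NOT printed) gives `LocalRate R (Γ ρ) θ`
(`localRate_of_residual`) — it names the two inputs, it proves nothing about them; §6 NON-VACUITY (`Witness.ne3Shape`: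
readings `(1/2)^k`) and NON-TRIVIALITY (`Witness.not_actionRate_linear`: readings `k` satisfy `ActionRate` for NO
`C` and NO `θ < 1`), so the shape is neither contradictory nor empty of content.
-/

namespace Literature.MathematicalPhysics.QuantumFieldTheory.Balaban1983to89.T4EtaRateMin

open Filter Topology Finset
open Literature.MathematicalPhysics.QuantumFieldTheory.Balaban1983to89.T4CauchySum (GeomRate)

noncomputable section

/-! ## §1 The carrier and the shapes -/

/-- ABSTRACT CARRIER of the readings of the two runs' minimisers (no axioms: an interface, NOT an existence claim).
`dom` = admissible unit-lattice data (intended: `V` with `|∂V − 1| < ε₁`, [Balaban1985Variational] (7));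
`act k V` = a scalar reading of the k-step run (intended: the minimal action value `A^{L^{-k}}(U_k(V))`, (5) p. 278);
`loc k V x` = a local reading at the unit-scale site `x` (intended: a gauge-invariant local function of `U_k(V)` near
`x`, or a gauge-fixed component at King's corresponding points); `vol` = the volume factor (intended `|T₁|`).
[folklore] -/
structure Readings (ι X : Type*) where
  /-- admissible data -/
  dom : Set ι
  /-- scalar (global) reading of the k-step run -/
  act : ℕ → ι → ℝ
  /-- local reading of the k-step run at a unit-scale site -/
  loc : ℕ → ι → X → ℝ
  /-- volume factor -/
  vol : ℝ
  vol_nonneg : 0 ≤ vol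

variable {ι X : Type*}

/-- HYPOTHESIS SHAPE NE3 (action values): consecutive runs' scalar readings differ by at most `C θ^k · vol`,
uniformly in the admissible datum.  NOT in print for Bałaban's minimisers (module docstring); the printed template of
an η-comparison with a rate is King's (3.71) (A = 0). [cite: King1986, Prop. 3.8 (3.71) p. 664] -/
def ActionRate (R : Readings ι X) (C θ : ℝ) : Prop :=
  ∀ k : ℕ, ∀ V ∈ R.dom, |R.act (k + 1) V - R.act k V| ≤ C * θ ^ k * R.vol

/-- HYPOTHESIS SHAPE NE3 (local readings): consecutive runs' local readings differ by at most `C θ^k` at every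
unit-scale site, uniformly in the admissible datum.  NOT in print for Bałaban's minimisers; template King (3.71).
[cite: King1986, Prop. 3.8 (3.71) p. 664] -/
def LocalRate (R : Readings ι X) (C θ : ℝ) : Prop :=
  ∀ k : ℕ, ∀ V ∈ R.dom, ∀ x : X, |R.loc (k + 1) V x - R.loc k V x| ≤ C * θ ^ k

/-- HYPOTHESIS SHAPE NE3 (both readings, with an honest rate `0 ≤ θ < 1`). [cite: King1986, Prop. 3.8 (3.71) p. 664] -/
structure NE3Shape (R : Readings ι X) (C θ : ℝ) : Prop where
  rate_nonneg : 0 ≤ θ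
  rate_lt_one : θ < 1
  action : ActionRate R C θ
  pointwise : LocalRate R C θ

/-- Dictionary to node U6's input shape: an `ActionRate` is, datum by datum, a `T4CauchySum.GeomRate` of the
consecutive differences with constant `C · vol`. [folklore] -/
theorem ActionRate.geomRate {R : Readings ι X} {C θ : ℝ} (h : ActionRate R C θ) {V : ι} (hV : V ∈ R.dom) :
    GeomRate (C * R.vol) θ (fun k => R.act (k + 1) V - R.act k V) := by
  intro j
  have := h j V hV
  calc |R.act (j + 1) V - R.act j V| ≤ C * θ ^ j * R.vol := this
    _ = C * R.vol * θ ^ j := by ring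

/-- Dictionary to node U6's input shape, local version. [folklore] -/
theorem LocalRate.geomRate {R : Readings ι X} {C θ : ℝ} (h : LocalRate R C θ) {V : ι} (hV : V ∈ R.dom) (x : X) :
    GeomRate C θ (fun k => R.loc (k + 1) V x - R.loc k V x) :=
  fun j => h j V hV x

/-- Monotonicity in the constants. [folklore] -/
theorem LocalRate.mono {R : Readings ι X} {C C' θ θ' : ℝ} (h : LocalRate R C θ) (hC : C ≤ C') (hθ0 : 0 ≤ θ)
    (hθ : θ ≤ θ') (hC0 : 0 ≤ C) : LocalRate R C' θ' := by
  intro k V hV x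
  refine (h k V hV x).trans ?_
  exact mul_le_mul hC (pow_le_pow_left₀ hθ0 hθ k) (pow_nonneg hθ0 k) (hC0.trans hC)

/-! ## §2 Limits with geometric tails -/

/-- A real sequence whose consecutive differences are `≤ C θ^k` with `θ < 1` converges, and stays within the
geometric tail `C θ^k / (1 − θ)` of its limit. [folklore] -/
theorem exists_limit_of_geomRate {C θ : ℝ} {u : ℕ → ℝ} (hθ : θ < 1)
    (h : GeomRate C θ (fun k => u (k + 1) - u k)) :
    ∃ a : ℝ, Tendsto u atTop (𝓝 a) ∧ ∀ k : ℕ, |u k - a| ≤ C * θ ^ k / (1 - θ) := by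
  have hu : ∀ n, dist (u n) (u (n + 1)) ≤ C * θ ^ n := by
    intro n
    rw [Real.dist_eq, abs_sub_comm]
    exact h n
  obtain ⟨a, ha⟩ := cauchySeq_tendsto_of_complete (cauchySeq_of_le_geometric θ C hθ hu)
  refine ⟨a, ha, fun k => ?_⟩
  have := dist_le_of_le_geometric_of_tendsto θ C hθ hu ha k
  rwa [Real.dist_eq] at this

/-- Under `ActionRate`, each datum's scalar readings converge with the tail `C vol θ^k/(1−θ)`. [folklore] -/
theorem ActionRate.exists_limit {R : Readings ι X} {C θ : ℝ} (h : ActionRate R C θ) (hθ : θ < 1) {V : ι}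
    (hV : V ∈ R.dom) :
    ∃ a : ℝ, Tendsto (fun k => R.act k V) atTop (𝓝 a) ∧ ∀ k : ℕ, |R.act k V - a| ≤ C * R.vol * θ ^ k / (1 - θ) :=
  exists_limit_of_geomRate hθ (h.geomRate hV)

/-- Under `LocalRate`, each local reading converges with the tail `C θ^k/(1−θ)`. [folklore] -/
theorem LocalRate.exists_limit {R : Readings ι X} {C θ : ℝ} (h : LocalRate R C θ) (hθ : θ < 1) {V : ι}
    (hV : V ∈ R.dom) (x : X) :
    ∃ a : ℝ, Tendsto (fun k => R.loc k V x) atTop (𝓝 a) ∧ ∀ k : ℕ, |R.loc k V x - a| ≤ C * θ ^ k / (1 - θ) :=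
  exists_limit_of_geomRate hθ (h.geomRate hV x)

/-! ## §3 The consecutive shape implies King's n-uniform shape -/

/-- Telescoping: consecutive differences `≤ C θ^i` give `|u (k+n) − u k| ≤ C θ^k/(1−θ)` for EVERY `n` — the form of
King's (3.71) (`k + n` versus `k` steps, constant independent of `n`). [cite: King1986, Prop. 3.8 (3.71) p. 664] -/
theorem abs_sub_le_of_geomRate {C θ : ℝ} {u : ℕ → ℝ} (hθ0 : 0 ≤ θ) (hθ1 : θ < 1)
    (h : GeomRate C θ (fun k => u (k + 1) - u k)) (k n : ℕ) :
    |u (k + n) - u k| ≤ C * θ ^ k / (1 - θ) := by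
  have hC : 0 ≤ C := by
    have := (abs_nonneg _).trans (h 0)
    simpa using this
  have h1 : dist (u k) (u (k + n)) ≤ ∑ i ∈ Ico k (k + n), dist (u i) (u (i + 1)) :=
    dist_le_Ico_sum_dist u (Nat.le_add_right k n)
  have h2 : ∑ i ∈ Ico k (k + n), dist (u i) (u (i + 1)) ≤ ∑ i ∈ Ico k (k + n), C * θ ^ i := by
    refine sum_le_sum fun i _ => ?_
    rw [Real.dist_eq, abs_sub_comm]
    exact h i
  have h3 : ∑ i ∈ Ico k (k + n), C * θ ^ i ≤ C * (θ ^ k / (1 - θ)) := by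
    rw [← mul_sum]
    exact mul_le_mul_of_nonneg_left (geom_sum_Ico_le_of_lt_one hθ0 hθ1) hC
  rw [abs_sub_comm, ← Real.dist_eq]
  calc dist (u k) (u (k + n)) ≤ C * (θ ^ k / (1 - θ)) := h1.trans (h2.trans h3)
    _ = C * θ ^ k / (1 - θ) := by ring

/-- King's n-uniform form for the local readings. [cite: King1986, Prop. 3.8 (3.71) p. 664] -/
theorem LocalRate.multiStep {R : Readings ι X} {C θ : ℝ} (h : LocalRate R C θ) (hθ0 : 0 ≤ θ) (hθ1 : θ < 1)
    {V : ι} (hV : V ∈ R.dom) (x : X) (k n : ℕ) :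
    |R.loc (k + n) V x - R.loc k V x| ≤ C * θ ^ k / (1 - θ) :=
  abs_sub_le_of_geomRate (u := fun j => R.loc j V x) hθ0 hθ1 (h.geomRate hV x) k n

/-- King's n-uniform form for the scalar readings. [cite: King1986, Prop. 3.8 (3.71) p. 664] -/
theorem ActionRate.multiStep {R : Readings ι X} {C θ : ℝ} (h : ActionRate R C θ) (hθ0 : 0 ≤ θ) (hθ1 : θ < 1)
    {V : ι} (hV : V ∈ R.dom) (k n : ℕ) :
    |R.act (k + n) V - R.act k V| ≤ C * R.vol * θ ^ k / (1 - θ) :=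
  abs_sub_le_of_geomRate (u := fun j => R.act j V) hθ0 hθ1 (h.geomRate hV) k n

/-! ## §4 Local ⇒ global -/

/-- If the scalar reading is the SUM of the local readings over the (finitely many) unit-scale sites and the number
of sites is at most `vol`, a `LocalRate` gives an `ActionRate` with the same constants — the meaning of the factor
`|T₁|` in NE3's action-value clause. [folklore] -/
theorem actionRate_of_localRate [Fintype X] {R : Readings ι X} {C θ : ℝ}
    (hact : ∀ k : ℕ, ∀ V ∈ R.dom, R.act k V = ∑ x, R.loc k V x) (hvol : (Fintype.card X : ℝ) ≤ R.vol)
    (hC : 0 ≤ C) (hθ : 0 ≤ θ) (h : LocalRate R C θ) : ActionRate R C θ := by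
  intro k V hV
  rw [hact (k + 1) V hV, hact k V hV, ← sum_sub_distrib]
  calc |∑ x, (R.loc (k + 1) V x - R.loc k V x)| ≤ ∑ x, |R.loc (k + 1) V x - R.loc k V x| :=
        abs_sum_le_sum_abs _ _
    _ ≤ ∑ _x : X, C * θ ^ k := sum_le_sum fun x _ => h k V hV x
    _ = (Fintype.card X : ℝ) * (C * θ ^ k) := by simp [sum_const, nsmul_eq_mul]
    _ ≤ R.vol * (C * θ ^ k) := mul_le_mul_of_nonneg_right hvol (mul_nonneg hC (pow_nonneg hθ k))
    _ = C * θ ^ k * R.vol := by ring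

/-! ## §5 The residual mechanism, as a shape -/

/-- RESIDUAL MECHANISM (names the two inputs of the natural argument for NE3, proves nothing about them): if the
difference of consecutive local readings is controlled by a UNIFORM response constant `Γ` times a residual `res k V`
(R1 — of the printed η-uniform type: invertibility of the linearised constrained Euler–Lagrange operator at the
minimiser in the scaled norms), and the residual has geometric size `res k V ≤ ρ θ^k` (R2 — the block-averaged fine
minimiser almost solves the coarse constrained Euler–Lagrange system, with a rate; NOT in print), then
`LocalRate R (Γ ρ) θ`. [folklore] -/
theorem localRate_of_residual {R : Readings ι X} {Γ ρ θ : ℝ} (res : ℕ → ι → ℝ) (hΓ : 0 ≤ Γ)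
    (hresp : ∀ k : ℕ, ∀ V ∈ R.dom, ∀ x : X, |R.loc (k + 1) V x - R.loc k V x| ≤ Γ * res k V)
    (hres : ∀ k : ℕ, ∀ V ∈ R.dom, res k V ≤ ρ * θ ^ k) : LocalRate R (Γ * ρ) θ := by
  intro k V hV x
  calc |R.loc (k + 1) V x - R.loc k V x| ≤ Γ * res k V := hresp k V hV x
    _ ≤ Γ * (ρ * θ ^ k) := mul_le_mul_of_nonneg_left (hres k V hV) hΓ
    _ = Γ * ρ * θ ^ k := by ring

/-! ## §6 Non-vacuity and non-triviality -/

namespace Witness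

/-- Readings `(1/2)^k` (one datum, one site, `vol = 1`, action = the local reading). [folklore] -/
def geom : Readings Unit Unit where
  dom := Set.univ
  act := fun k _ => (1 / 2 : ℝ) ^ k
  loc := fun k _ _ => (1 / 2 : ℝ) ^ k
  vol := 1
  vol_nonneg := zero_le_one

/-- Readings `k` (no rate at all). [folklore] -/
def linear : Readings Unit Unit where
  dom := Set.univ
  act := fun k _ => (k : ℝ)
  loc := fun k _ _ => (k : ℝ)
  vol := 1
  vol_nonneg := zero_le_one

/-- The consecutive difference of `(1/2)^k` in absolute value. [folklore] -/
theorem geom_step (k : ℕ) : |(1 / 2 : ℝ) ^ (k + 1) - (1 / 2) ^ k| = (1 / 2) * (1 / 2) ^ k := by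
  rw [pow_succ, abs_sub_comm]
  have h : (1 / 2 : ℝ) ^ k - (1 / 2) ^ k * (1 / 2) = (1 / 2) * (1 / 2) ^ k := by ring
  rw [h, abs_of_nonneg (by positivity)]

/-- NON-VACUITY: the readings `(1/2)^k` satisfy `NE3Shape` with `C = 1`, `θ = 1/2`. [folklore] -/
theorem ne3Shape : NE3Shape geom 1 (1 / 2) where
  rate_nonneg := by norm_num
  rate_lt_one := by norm_num
  action := by
    intro k V _
    show |(1 / 2 : ℝ) ^ (k + 1) - (1 / 2) ^ k| ≤ 1 * (1 / 2) ^ k * 1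
    rw [geom_step]
    have : (0 : ℝ) ≤ (1 / 2) ^ k := by positivity
    nlinarith
  pointwise := by
    intro k V _ x
    show |(1 / 2 : ℝ) ^ (k + 1) - (1 / 2) ^ k| ≤ 1 * (1 / 2) ^ k
    rw [geom_step]
    have : (0 : ℝ) ≤ (1 / 2) ^ k := by positivity
    nlinarith

/-- NON-TRIVIALITY: the readings `k` satisfy `ActionRate` for NO constant `C` and NO rate `θ < 1` — the shape has
content (it fails for a non-convergent family). [folklore] -/
theorem not_actionRate_linear (C θ : ℝ) (hθ1 : θ < 1) : ¬ ActionRate linear C θ := by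
  intro h
  have hstep : ∀ k : ℕ, (1 : ℝ) ≤ C * θ ^ k := by
    intro k
    have := h k () (Set.mem_univ _)
    simp only [linear, Nat.cast_add, Nat.cast_one, add_sub_cancel_left, abs_one, mul_one] at this
    exact this
  have hC : 0 < C := by
    have := hstep 0
    simp at this
    linarith
  obtain ⟨n, hn⟩ := exists_pow_lt_of_lt_one (inv_pos.mpr hC) hθ1
  have h1 := hstep n
  have h2 : C * θ ^ n < C * C⁻¹ := mul_lt_mul_of_pos_left hn hC
  rw [mul_inv_cancel₀ hC.ne'] at h2
  linarith

end Witness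

end

end Literature.MathematicalPhysics.QuantumFieldTheory.Balaban1983to89.T4EtaRateMin
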